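import Literature.Analysis.FluidPDE.TaoClassGlue
import Literature.Analysis.FluidPDE.H1ContinuationSobolevClass
import Literature.Analysis.FluidPDE.TaoLocalisation
import Literature.Analysis.FluidPDE.TaoLocalisationContinuation
import HarnessLib

/-!
# Route `GaldiLiouvilleGate`, crux `RecordZoomAncient` (stmt-NavierStokesRegularity-0894),
  line `registered` (birth skeleton, reshape r5) — stub `stub_velocityBranch`
  (frequent critical velocity gives velocity-concentrated enstrophy-normalised zooms)

**Statement.** Write `E(s) = ∫⁻ |∇u(s)|²` for a classical solution `u` of the unforced
Navier–Stokes system on `ℝ³ × [0, T)` which is Leray–Hopf, Tao-class on every `[0, T']`,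
`T' < T`, and admits no smooth extension past `T`. Inputs: the persistence bound of the
enstrophy (`E(t₀) ≤ L ⇒ E(t) ≤ K_P L` for `t ∈ [t₀, T)`, `t − t₀ ≤ c_P ν³/L²`), a fraction
`θ₀ > 0`, and FREQUENT CRITICAL VELOCITY: arbitrarily close to `T` there are a time `t`, a level
`L > 0` dominating `E` on `[0, t]` and a point `x` with `‖u(t, x)‖ ≥ θ₀ L/ν` (the velocity is,
somewhere, comparable with the enstrophy-critical velocity `L/ν`; equivalently the local
Reynolds number `L/(ν ‖u(t)‖_∞)` of the enstrophy-carrying scale stays bounded infinitely often).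
Output: base times `tc n ∈ (0, T)`, centres `xc n`, levels `L n > 0` dominating `E` on
`[0, tc n]`, a rescaled time `s₀ < 0` and a `θ > 0` with `tc n · (L n)² → ∞` and
`θ ≤ ‖(ν / L n) • u (tc n + ν³ s₀/(L n)²) (xc n)‖`. This is the bookkeeping shared by the
Type-I, fast-doubling and enstrophy-concentration branches, isolated: its negation ("FAINT":
`ν ‖u(t)‖_∞ / sup_{[0,t]} E → 0`) is the fourth structural hypothesis handed to the open kernel.

**Proof.** (a) `E` is unbounded on `[0, T)` (no smooth extension + `H¹` continuation,
`exists_enstrophy_gt`). (b) ROOM: `E ≤ L'` on `[0, t]` forces `T − t > c_P ν³/L'²` (persistence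
would otherwise bound `E` on `[0, T)`). (c) `E` is bounded on `[0, T/2]` (Sobolev bound of the Tao
representation). (d) Probing at times `t*ₙ > T/2` with `E(t*ₙ) > n`, the hypothesis gives
`t ≥ t*ₙ`, a level `L > n` and a point `x`. (e) Witnesses: `L n = K_P L`, `xc n = x`,
`tc n = t + c_P ν³/(2L²)` (inside the room of (b); `E ≤ L n` on `[0, tc n]` by domination on
`[0, t]` and persistence from `t`), `s₀ = −c_P K_P²/2` (so that the rescaled time `s₀` of the zoom
based at `tc n` is the original time `t`), `θ = θ₀/K_P`; finally `tc n > T/2` and `L n > n` give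
`tc n (L n)² ≥ (T/2) n² → ∞`.
-/

noncomputable section

open Set MeasureTheory Filter Topology Function Metric
open scoped ENNReal NNReal
open Literature.Analysis.FluidPDE

namespace Summit.NavierStokesRegularity.NavierStokesRegularity.Theorems.RecordZoomAncient.Birth

-- the problem-side namespace `Summit.NavierStokesRegularity.NavierStokesRegularity.…` (summit =
-- problem for this single-problem summit) duplicates `NavierStokesRegularity` by design
set_option linter.dupNamespace false

/-- **(a) The enstrophy is unbounded before a blow-up time.** For a classical solution on
`[0, T)` which is Leray–Hopf, Tao-class on every `[0, T']`, `T' < T`, and has no smooth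
extension past `T`, the enstrophy `E(t) = ∫⁻ |∇u(t)|²` exceeds every finite level somewhere on
`[0, T)`: otherwise `‖u(t)‖²_{L²} + ‖∇u(t)‖²_{L²}` is bounded on `[0, T)` (energy inequality) and
`hasSobolevExtensionPast_of_uniform_H1_bound` continues `u` past `T`. -/
private theorem exists_enstrophy_gt' {ν T : ℝ} (hν : 0 < ν) (hT : 0 < T)
    {u : ℝ → EuclideanSpace ℝ (Fin 3) → EuclideanSpace ℝ (Fin 3)}
    {p : ℝ → EuclideanSpace ℝ (Fin 3) → ℝ}
    (hsol : IsClassicalNSSolutionOn (Ico 0 T) ν 0 u p) (hLH : IsLerayHopfOn T ν 0 (u 0) u)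
    (hrep : ∀ T' ∈ Ioo 0 T, ∃ P : ℝ → EuclideanSpace ℝ (Fin 3) → ℝ,
      IsTaoSolutionOn T' ν (u 0) u P)
    (hnext : ¬ HasSmoothExtensionPast ν 0 u T) {E : ℝ → ℝ≥0∞}
    (hE : ∀ s, E s = ∫⁻ x, ENNReal.ofReal (frobeniusNormSq (fderiv ℝ (u s) x))) {M : ℝ≥0∞}
    (hM : M < ⊤) : ∃ t ∈ Ico 0 T, M < E t := by
  by_contra h
  push Not at h
  -- the Sobolev class on every `[0, T'']`, `T'' < T`, from the representation
  have hreg : ∀ T'' < T, HasBoundedSobolevNormsOn (Icc 0 T'') u := fun T'' hT'' => by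
    obtain ⟨P, hP⟩ := hrep (max T'' (T / 2))
      ⟨(half_pos hT).trans_le (le_max_right _ _), max_lt hT'' (half_lt_self hT)⟩
    exact hP.sobolev.mono (Icc_subset_Icc_right (le_max_left _ _))
  have hKE : 0 ≤ VectorCalculus.kineticEnergy (u 0) := kineticEnergy_nonneg _
  have h2KE : 0 ≤ 2 * VectorCalculus.kineticEnergy (u 0) := by positivity
  have hA0 : 0 ≤ 2 * VectorCalculus.kineticEnergy (u 0) + M.toReal :=
    add_nonneg h2KE ENNReal.toReal_nonneg
  refine hnext (hasSobolevExtensionPast_of_uniform_H1_bound hν hT hsol hreg hA0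
    fun t ht => ?_).hasSmoothExtensionPast
  rw [ENNReal.ofReal_add h2KE ENNReal.toReal_nonneg, ENNReal.ofReal_toReal hM.ne, ← hE t]
  exact add_le_add (hLH.lintegral_enorm_sq_le hν.le (Ico_subset_Icc_self ht)) (h t ht)

/-- The base time `t + c_P ν³/(2L²)` zoomed at level `K_P · L` to the rescaled time
`s₀ = −c_P K_P²/2` is the original time `t`. -/
private theorem base_time_identity' {ν KP L cP t : ℝ} (hKP : KP ≠ 0) (hL : L ≠ 0) :
    t + cP * ν ^ 3 / (2 * L ^ 2) + ν ^ 3 / (KP * L) ^ 2 * -(cP * KP ^ 2 / 2) = t := by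
  field_simp
  ring

/-- At the velocity scale `ν/(K_P · L)` the velocity `θ₀ L/ν` reads `θ₀/K_P`. -/
private theorem velocity_scale' (θ₀ : ℝ) {ν KP L : ℝ} (hν : ν ≠ 0) (hKP : KP ≠ 0) (hL : L ≠ 0) :
    ν / (KP * L) * (θ₀ * L / ν) = θ₀ / KP := by
  field_simp

/-- `a/(2L²) ≤ a/L²` for `a ≥ 0`. -/
private theorem half_sq_le' {a L : ℝ} (ha : 0 ≤ a) (hL : 0 < L) :
    a / (2 * L ^ 2) ≤ a / L ^ 2 :=
  div_le_div_of_nonneg_left ha (by positivity) (by nlinarith)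

/-- **stub 2e — `stub_velocityBranch` (frequent critical velocity gives velocity-concentrated
zooms).** Hypotheses: the solution (classical on `[0, T)`, Leray–Hopf, Tao-class on every
`[0, T']`, no smooth extension past `T`), the persistence bound (constants `c_P > 0`, `K_P ≥ 1`),
a fraction `θ₀ > 0`, and FREQUENT CRITICAL VELOCITY: arbitrarily close to `T` a time `t`, a point
`x` and a level `L > 0` dominating `E` on `[0, t]` with `‖u(t, x)‖ ≥ θ₀ L/ν`. Conclusion:
concentrated zooms in the velocity format of the composition. Proof: (a) `E` is unbounded on
`[0, T)` (`exists_enstrophy_gt'`); (b) ROOM: `E ≤ L'` on `[0, t]` forces `T − t > c_P ν³/L'²`;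
(c) `E` is bounded on `[0, T/2]`; (d) probe where `E > max n (bound)`; (e) level `L n = K_P · L`,
base time `tc = t + c_P ν³/(2L²)`, `s₀ = −c_P K_P²/2`, `θ = θ₀/K_P`, and
`tc n (L n)² ≥ (T/2) n² → ∞`. -/
theorem stub_velocityBranch :
    ∀ (ν T : ℝ), 0 < ν → 0 < T →
      ∀ (u : ℝ → EuclideanSpace ℝ (Fin 3) → EuclideanSpace ℝ (Fin 3)) (p : ℝ → EuclideanSpace ℝ (Fin 3) → ℝ),
        IsClassicalNSSolutionOn (Set.Ico 0 T) ν 0 u p → IsLerayHopfOn T ν 0 (u 0) u →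
        (∀ T' ∈ Set.Ioo 0 T, ∃ P : ℝ → EuclideanSpace ℝ (Fin 3) → ℝ, IsTaoSolutionOn T' ν (u 0) u P) →
        ¬ HasSmoothExtensionPast ν 0 u T →
        ∀ cP KP : ℝ, 0 < cP → 1 ≤ KP →
          (∀ t₀ ∈ Set.Ico 0 T, ∀ L : ℝ, 0 < L →
            (∫⁻ x, ENNReal.ofReal (frobeniusNormSq (fderiv ℝ (u t₀) x))) ≤ ENNReal.ofReal L →
            ∀ t ∈ Set.Ico t₀ T, t - t₀ ≤ cP * ν ^ 3 / L ^ 2 →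
              (∫⁻ x, ENNReal.ofReal (frobeniusNormSq (fderiv ℝ (u t) x))) ≤ ENNReal.ofReal (KP * L)) →
        ∀ θ₀ : ℝ, 0 < θ₀ →
          (∀ t' ∈ Set.Ico 0 T, ∃ t ∈ Set.Ico t' T, ∃ x : EuclideanSpace ℝ (Fin 3), ∃ L : ℝ, 0 < L ∧
            (∀ s ∈ Set.Icc 0 t,
              (∫⁻ x, ENNReal.ofReal (frobeniusNormSq (fderiv ℝ (u s) x))) ≤ ENNReal.ofReal L) ∧
            θ₀ * L / ν ≤ ‖u t x‖) →
        ∃ (tc : ℕ → ℝ) (xc : ℕ → EuclideanSpace ℝ (Fin 3)) (L : ℕ → ℝ) (s₀ θ : ℝ),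
          s₀ < 0 ∧ 0 < θ ∧ (∀ n, 0 < tc n ∧ tc n < T) ∧ (∀ n, 0 < L n) ∧
          (∀ n, ∀ t ∈ Set.Icc 0 (tc n),
            ∫⁻ x, ENNReal.ofReal (frobeniusNormSq (fderiv ℝ (u t) x)) ≤ ENNReal.ofReal (L n)) ∧
          Tendsto (fun n => tc n * L n ^ 2) atTop atTop ∧
          (∀ n, θ ≤ ‖(ν / L n) • u (tc n + ν ^ 3 / L n ^ 2 * s₀) (xc n)‖) := by
  intro ν T hν hT u p hsol hLH hrep hnext cP KP hcP hKP hpers θ₀ hθ₀ hV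
  have hKP0 : 0 < KP := one_pos.trans_le hKP
  -- the enstrophy `E s = ∫⁻ |∇u(s)|²`
  obtain ⟨E, hE⟩ : ∃ E : ℝ → ℝ≥0∞,
      ∀ s, E s = ∫⁻ x, ENNReal.ofReal (frobeniusNormSq (fderiv ℝ (u s) x)) := ⟨_, fun _ => rfl⟩
  simp only [← hE] at hpers hV ⊢
  -- (a) unboundedness of `E` on `[0, T)`
  have hunb : ∀ M : ℝ≥0∞, M < ⊤ → ∃ t ∈ Ico 0 T, M < E t := fun M hM =>
    exists_enstrophy_gt' hν hT hsol hLH hrep hnext hE hM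
  -- (b) ROOM before `T` below a dominated time
  have hroom : ∀ t ∈ Ico 0 T, ∀ L' : ℝ, 0 < L' → (∀ r ∈ Icc 0 t, E r ≤ ENNReal.ofReal L') →
      cP * ν ^ 3 / L' ^ 2 < T - t := by
    intro t ht L' hL' hdomt
    by_contra hle
    push Not at hle
    obtain ⟨t', ht', hgt⟩ := hunb (ENNReal.ofReal (KP * L')) ENNReal.ofReal_lt_top
    refine absurd ?_ (not_le.2 hgt)
    rcases le_or_gt t' t with h1 | h1
    · exact (hdomt t' ⟨ht'.1, h1⟩).trans
        (ENNReal.ofReal_le_ofReal (le_mul_of_one_le_left hL'.le hKP))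
    · exact hpers t ht L' hL' (hdomt t ⟨ht.1, le_rfl⟩) t' ⟨h1.le, ht'.2⟩ (by linarith [ht'.2])
  -- (c) a bound for `E` on `[0, T/2]`
  obtain ⟨P₀, hP₀⟩ := hrep (T / 2) ⟨half_pos hT, half_lt_self hT⟩
  obtain ⟨C₀, hC₀⟩ := hP₀.sobolev 1
  have hB : ∀ t ∈ Icc 0 (T / 2), E t ≤ 3 * (C₀ : ℝ≥0∞) := fun t ht => by
    rw [hE]
    exact (lintegral_frobeniusNormSq_le_three_mul_iteratedFDeriv_one (u t)).trans
      (mul_le_mul_right (hC₀ t ht) 3)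
  have hBtop : 3 * (C₀ : ℝ≥0∞) < ⊤ := ENNReal.mul_lt_top (by simp) ENNReal.coe_lt_top
  -- (d) probing times `tp n > T/2` with `E (tp n) > n`, and the critical velocities after them
  have hprobe : ∀ n : ℕ, ∃ t ∈ Ico 0 T, T / 2 < t ∧ (n : ℝ≥0∞) < E t := fun n => by
    obtain ⟨t, ht, hgt⟩ :=
      hunb (max (n : ℝ≥0∞) (3 * C₀)) (max_lt (ENNReal.natCast_lt_top n) hBtop)
    refine ⟨t, ht, ?_, (le_max_left _ _).trans_lt hgt⟩
    by_contra hle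
    push Not at hle
    exact absurd ((hB t ⟨ht.1, hle⟩).trans (le_max_right _ _)) (not_le.2 hgt)
  choose tp htp htp2 htpn using hprobe
  choose t ht x L hL hdomt hvel0 using fun n => hV (tp n) (htp n)
  have ht0 : ∀ n, 0 < t n := fun n => (htp2 n).trans_le (ht n).1 |> (half_pos hT).trans
  have htT : ∀ n, t n < T := fun n => (ht n).2
  -- (e) the base times `tc n = t n + c_P ν³/(2 (L n)²)`
  obtain ⟨tc, htc_def⟩ : ∃ tc : ℕ → ℝ, ∀ n, tc n = t n + cP * ν ^ 3 / (2 * L n ^ 2) :=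
    ⟨_, fun _ => rfl⟩
  have hδ : ∀ n, 0 < cP * ν ^ 3 / (2 * L n ^ 2) := fun n => by
    have hLn := hL n
    positivity
  have httc : ∀ n, t n ≤ tc n := fun n => by rw [htc_def]; linarith [hδ n]
  have htc : ∀ n, 0 < tc n ∧ tc n < T := fun n => by
    have hLn := hL n
    have hr := hroom (t n) ⟨(ht0 n).le, htT n⟩ (L n) hLn (hdomt n)
    have hq : cP * ν ^ 3 / (2 * L n ^ 2) ≤ cP * ν ^ 3 / L n ^ 2 :=
      half_sq_le' (by positivity) hLn
    rw [htc_def]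
    exact ⟨by linarith [ht0 n, hδ n], by linarith⟩
  -- domination of `E` by `K_P · L n` on `[0, tc n]`
  have hdom : ∀ n, ∀ r ∈ Icc 0 (tc n), E r ≤ ENNReal.ofReal (KP * L n) := by
    intro n r hr
    have hLn := hL n
    rcases le_or_gt r (t n) with hle | hlt
    · exact (hdomt n r ⟨hr.1, hle⟩).trans
        (ENNReal.ofReal_le_ofReal (le_mul_of_one_le_left hLn.le hKP))
    · refine hpers (t n) ⟨(ht0 n).le, htT n⟩ (L n) hLn (hdomt n (t n) ⟨(ht0 n).le, le_rfl⟩)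
        r ⟨hlt.le, hr.2.trans_lt (htc n).2⟩ ?_
      calc r - t n ≤ cP * ν ^ 3 / (2 * L n ^ 2) := by linarith [hr.2, htc_def n]
        _ ≤ cP * ν ^ 3 / L n ^ 2 := half_sq_le' (by positivity) hLn
  -- `tc n · (L n)² → ∞`
  have htend : Tendsto (fun n => tc n * (KP * L n) ^ 2) atTop atTop := by
    have h0 : Tendsto (fun n : ℕ => T / 2 * (n : ℝ) ^ 2) atTop atTop :=
      Tendsto.const_mul_atTop (half_pos hT)
        ((tendsto_pow_atTop two_ne_zero).comp tendsto_natCast_atTop_atTop)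
    refine tendsto_atTop_mono (f := fun n : ℕ => T / 2 * (n : ℝ) ^ 2) (fun n => ?_) h0
    have hLn := hL n
    have hnL' : (n : ℝ) < L n :=
      ENNReal.natCast_lt_ofReal.1 ((htpn n).trans_le (hdomt n (tp n) ⟨(htp n).1, (ht n).1⟩))
    have hnL : (n : ℝ) ≤ KP * L n := hnL'.le.trans (le_mul_of_one_le_left hLn.le hKP)
    have htcn : T / 2 ≤ tc n := ((htp2 n).le.trans (ht n).1).trans (httc n)
    exact mul_le_mul htcn (pow_le_pow_left₀ (Nat.cast_nonneg n) hnL 2) (by positivity)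
      ((half_pos hT).le.trans htcn)
  -- the velocity at the rescaled time `s₀` (the original time `t n`) and the centre `x n`
  have hvel : ∀ n, θ₀ / KP ≤
      ‖(ν / (KP * L n)) • u (tc n + ν ^ 3 / (KP * L n) ^ 2 * -(cP * KP ^ 2 / 2)) (x n)‖ :=
    fun n => by
    have hLn := hL n
    have htime : tc n + ν ^ 3 / (KP * L n) ^ 2 * -(cP * KP ^ 2 / 2) = t n := by
      rw [htc_def]
      exact base_time_identity' hKP0.ne' hLn.ne'
    have hcoef : 0 ≤ ν / (KP * L n) := by positivity
    rw [htime, norm_smul, Real.norm_of_nonneg hcoef, ← velocity_scale' θ₀ hν.ne' hKP0.ne' hLn.ne']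
    exact mul_le_mul_of_nonneg_left (hvel0 n) hcoef
  exact ⟨tc, x, fun n => KP * L n, -(cP * KP ^ 2 / 2), θ₀ / KP, neg_lt_zero.2 (by positivity),
    by positivity, htc, fun n => mul_pos hKP0 (hL n), hdom, htend, hvel⟩

end Summit.NavierStokesRegularity.NavierStokesRegularity.Theorems.RecordZoomAncient.Birth

end
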